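import Mathlib
import HarnessLib
import Summits.Ventures.LatticeQCDFlow.Scoring.ChainBatchMeans

/-!
# The batch-means statistic `ab · SE²_BM` as `(a/(a−1)) (V − W)`: the algebra, a sure bound
# `|ab · SE²_BM| ≤ 4 b C²`, measurability

HONEST FRAMING: exact (Metropolis-corrected) sampling algorithms for lattice gauge theory;
figures of merit are autocorrelation/cost numbers at stated couplings and volumes; no
continuum-physics claim.

Venture `LatticeQCDFlow` (cell pub-lqcd), topic `Scoring`; FANOUT row 8 (`s0-cpn-nemc`, GEN-19).
NEW WORK of the cell, not a published result; no definition is introduced.  Bookkeeping for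
`Scoring/BatchMeansConsistency.lean`: along a path `x : ℕ → Ω`, with `a` batches of length `b` and
batch means `Ȳ_j = (1/b) Σ_{i<b} f(x_{bj+i})`, the batch-means estimator of the asymptotic variance
is `σ̂²_{a,b} := ab · replicaSEsq(Ȳ)(a) = (b/(a−1)) Σ_{j<a} (Ȳ_j − Ȳ)²` (`Scoring/ReplicaError.replicaSEsq`,
the statistic of `Scoring/BatchMeans.lean`).  For ANY centring constant `c`, with the centred batch
sums `S_j = Σ_{i<b} (f(x_{bj+i}) − c)` and the centred total `T = Σ_{n<ba} (f(x_n) − c) = Σ_j S_j`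
(`Scoring/Thinning.sum_range_mul_eq_sum_sum`): `σ̂² = (a/(a−1)) ((1/a) Σ_j S_j²/b − T²/(b a²))` — the
form in which its moments are controlled — whence the sure bound `|σ̂²| ≤ 4 b C²` for `|f| ≤ C`
(take `c = 0`) and measurability.  Nothing is cited.

## Content

* **`batchMeans_sigmaHat_eq`** — `ab · SE²_BM = (a/(a−1)) ((1/a) Σ_{j<a} S_j²/b − T²/(b a²))`
  (`a ≥ 2`, `b ≥ 1`, any `c`);
* `abs_batchMeans_sigmaHat_le` — `|ab · SE²_BM| ≤ 4 b C²`; `measurable_batchMeans_sigmaHat`.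
-/

noncomputable section

namespace Summit.Ventures.LatticeQCDFlow.Scoring

open MeasureTheory ProbabilityTheory Filter Finset Preorder
open scoped ENNReal Topology

variable {Ω : Type*} [MeasurableSpace Ω]

/-! ### The algebra of the batch-means statistic -/

section Algebra

omit [MeasurableSpace Ω] in
/-- **`ab · SE²_BM = (a/(a−1)) (V − W)`**: with `S_j = Σ_{i<b} (f(x_{bj+i}) − c)` and
`T = Σ_{n<ba} (f(x_n) − c)` (any centring constant `c`),
`ab · replicaSEsq(batch means) = (a/(a−1)) ((1/a) Σ_{j<a} S_j²/b − T²/(b a²))`. -/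
theorem batchMeans_sigmaHat_eq (f : Ω → ℝ) (c : ℝ) {a b : ℕ} (ha : 2 ≤ a) (hb : b ≠ 0)
    (x : ℕ → Ω) :
    ((b * a : ℕ) : ℝ) * replicaSEsq (fun j (x : ℕ → Ω) => (∑ i ∈ Finset.range b, f (x (b * j + i))) / b) a x
      = ((a : ℝ) / ((a : ℝ) - 1)) *
        ((∑ j ∈ Finset.range a, (∑ i ∈ Finset.range b, (f (x (b * j + i)) - c)) ^ 2 / b) / a
          - (∑ n ∈ Finset.range (b * a), (f (x n) - c)) ^ 2 / ((b : ℝ) * (a : ℝ) ^ 2)) := by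
  have ha' : (a : ℝ) ≠ 0 := by exact_mod_cast (show a ≠ 0 by omega)
  have ha1 : (a : ℝ) - 1 ≠ 0 := by
    have : (2 : ℝ) ≤ a := by exact_mod_cast ha
    linarith
  have hb' : (b : ℝ) ≠ 0 := by exact_mod_cast hb
  set s : ℕ → ℝ := fun j => ∑ i ∈ Finset.range b, (f (x (b * j + i)) - c) with hs
  set T : ℝ := ∑ n ∈ Finset.range (b * a), (f (x n) - c) with hT
  -- the batch means and the grand mean in terms of `s j` and `T`
  have hY : ∀ j, (∑ i ∈ Finset.range b, f (x (b * j + i))) / (b : ℝ) = s j / b + c := by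
    intro j
    have : ∑ i ∈ Finset.range b, f (x (b * j + i)) = s j + b * c := by
      simp only [hs, Finset.sum_sub_distrib, Finset.sum_const, Finset.card_range, nsmul_eq_mul]
      ring
    rw [this]
    field_simp
  have hTs : T = ∑ j ∈ Finset.range a, s j := by
    simp only [hT, hs]
    exact sum_range_mul_eq_sum_sum (fun n => f (x n) - c) b a
  have hmean : replicaMean (fun j (x : ℕ → Ω) => (∑ i ∈ Finset.range b, f (x (b * j + i))) / b) a x
      = T / ((b : ℝ) * a) + c := by
    unfold replicaMean
    simp only [hY]
    rw [Finset.sum_add_distrib, Finset.sum_const, Finset.card_range, nsmul_eq_mul, ← Finset.sum_div,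
      ← hTs]
    field_simp
  -- expand the sum of squared deviations
  unfold replicaSEsq
  simp only [hY, hmean]
  have hdev : ∀ j, s j / b + c - (T / ((b : ℝ) * a) + c) = s j / b - T / ((b : ℝ) * a) := fun j => by
    ring
  simp only [hdev]
  have hexp : ∑ j ∈ Finset.range a, (s j / b - T / ((b : ℝ) * a)) ^ 2
      = (∑ j ∈ Finset.range a, s j ^ 2) / (b : ℝ) ^ 2 - T ^ 2 / ((a : ℝ) * (b : ℝ) ^ 2) := by
    have hpt : ∀ j ∈ Finset.range a, (s j / b - T / ((b : ℝ) * a)) ^ 2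
        = s j ^ 2 / (b : ℝ) ^ 2 - (2 * T / ((b : ℝ) ^ 2 * a)) * s j + T ^ 2 / ((b : ℝ) * a) ^ 2 := by
      intro j _
      field_simp
      ring
    rw [Finset.sum_congr rfl hpt, Finset.sum_add_distrib, Finset.sum_sub_distrib, ← Finset.mul_sum,
      ← hTs, Finset.sum_const, Finset.card_range, nsmul_eq_mul, ← Finset.sum_div]
    field_simp
    ring
  rw [hexp]
  have hsq : ∑ j ∈ Finset.range a, s j ^ 2 / (b : ℝ) = (∑ j ∈ Finset.range a, s j ^ 2) / b := by
    rw [Finset.sum_div]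
  rw [hsq]
  push_cast
  field_simp

omit [MeasurableSpace Ω] in
/-- **`|ab · SE²_BM| ≤ 4 b C²`** for `|f| ≤ C`, `a ≥ 2`, `b ≥ 1` (the statistic is bounded). -/
theorem abs_batchMeans_sigmaHat_le {f : Ω → ℝ} {C : ℝ} (hC : ∀ y, |f y| ≤ C) {a b : ℕ} (ha : 2 ≤ a)
    (hb : b ≠ 0) (x : ℕ → Ω) :
    |((b * a : ℕ) : ℝ) * replicaSEsq (fun j (x : ℕ → Ω) => (∑ i ∈ Finset.range b, f (x (b * j + i))) / b) a x|
      ≤ 4 * b * C ^ 2 := by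
  rw [batchMeans_sigmaHat_eq f 0 ha hb x]
  simp only [sub_zero]
  have ha2 : (2 : ℝ) ≤ a := by exact_mod_cast ha
  have haR : (0 : ℝ) < a := by linarith
  have hbR : (0 : ℝ) < b := Nat.cast_pos.2 (Nat.pos_of_ne_zero hb)
  have hC0 : 0 ≤ C := (abs_nonneg _).trans (hC (x 0))
  have hr0 : 0 ≤ (a : ℝ) / ((a : ℝ) - 1) := div_nonneg haR.le (by linarith)
  have hr2 : (a : ℝ) / ((a : ℝ) - 1) ≤ 2 := by rw [div_le_iff₀ (by linarith)]; linarith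
  -- `0 ≤ V ≤ b C²`
  have hS : ∀ j, |∑ i ∈ Finset.range b, f (x (b * j + i))| ≤ b * C := fun j =>
    (Finset.abs_sum_le_sum_abs _ _).trans ((Finset.sum_le_sum fun i _ => hC _).trans
      (by rw [Finset.sum_const, Finset.card_range, nsmul_eq_mul]))
  have hV0 : 0 ≤ (∑ j ∈ Finset.range a, (∑ i ∈ Finset.range b, f (x (b * j + i))) ^ 2 / (b : ℝ)) / a :=
    div_nonneg (Finset.sum_nonneg fun j _ => div_nonneg (sq_nonneg _) hbR.le) haR.le
  have hV1 : (∑ j ∈ Finset.range a, (∑ i ∈ Finset.range b, f (x (b * j + i))) ^ 2 / (b : ℝ)) / a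
      ≤ b * C ^ 2 := by
    rw [div_le_iff₀ haR]
    calc ∑ j ∈ Finset.range a, (∑ i ∈ Finset.range b, f (x (b * j + i))) ^ 2 / (b : ℝ)
        ≤ ∑ j ∈ Finset.range a, (b * C) ^ 2 / (b : ℝ) := Finset.sum_le_sum fun j _ =>
          div_le_div_of_nonneg_right ((sq_abs _).symm.trans_le
            (pow_le_pow_left₀ (abs_nonneg _) (hS j) 2)) hbR.le
      _ = b * C ^ 2 * a := by
          rw [Finset.sum_const, Finset.card_range, nsmul_eq_mul]; field_simp
  -- `0 ≤ W ≤ b C²`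
  have hT : |∑ n ∈ Finset.range (b * a), f (x n)| ≤ (b * a : ℕ) * C :=
    (Finset.abs_sum_le_sum_abs _ _).trans ((Finset.sum_le_sum fun i _ => hC _).trans
      (by rw [Finset.sum_const, Finset.card_range, nsmul_eq_mul]))
  have hW0 : 0 ≤ (∑ n ∈ Finset.range (b * a), f (x n)) ^ 2 / ((b : ℝ) * (a : ℝ) ^ 2) := by positivity
  have hW1 : (∑ n ∈ Finset.range (b * a), f (x n)) ^ 2 / ((b : ℝ) * (a : ℝ) ^ 2) ≤ b * C ^ 2 := by
    rw [div_le_iff₀ (by positivity)]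
    calc (∑ n ∈ Finset.range (b * a), f (x n)) ^ 2 ≤ ((b * a : ℕ) * C) ^ 2 :=
          (sq_abs _).symm.trans_le (pow_le_pow_left₀ (abs_nonneg _) hT 2)
      _ = b * C ^ 2 * ((b : ℝ) * (a : ℝ) ^ 2) := by push_cast; ring
  rw [abs_mul, abs_of_nonneg hr0]
  calc (a : ℝ) / ((a : ℝ) - 1) * |(∑ j ∈ Finset.range a,
        (∑ i ∈ Finset.range b, f (x (b * j + i))) ^ 2 / (b : ℝ)) / a
        - (∑ n ∈ Finset.range (b * a), f (x n)) ^ 2 / ((b : ℝ) * (a : ℝ) ^ 2)|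
      ≤ 2 * (b * C ^ 2 + b * C ^ 2) := by
        refine mul_le_mul hr2 ((abs_sub _ _).trans (add_le_add ?_ ?_)) (abs_nonneg _) zero_le_two
        · rw [abs_of_nonneg hV0]; exact hV1
        · rw [abs_of_nonneg hW0]; exact hW1
    _ = 4 * b * C ^ 2 := by ring

/-- The batch-means statistic `ab · SE²_BM` is a measurable function of the path. -/
theorem measurable_batchMeans_sigmaHat {f : Ω → ℝ} (hf : Measurable f) (a b : ℕ) :
    Measurable fun x : ℕ → Ω => ((b * a : ℕ) : ℝ)
      * replicaSEsq (fun j (x : ℕ → Ω) => (∑ i ∈ Finset.range b, f (x (b * j + i))) / b) a x := by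
  have hY : ∀ j, Measurable fun x : ℕ → Ω => (∑ i ∈ Finset.range b, f (x (b * j + i))) / (b : ℝ) :=
    fun j => (Finset.measurable_sum _ fun i _ => hf.comp (measurable_pi_apply _)).div_const _
  unfold replicaSEsq replicaMean
  exact measurable_const.mul ((Finset.measurable_sum _ fun j _ =>
    ((hY j).sub ((Finset.measurable_sum _ fun j _ => hY j).div_const _)).pow_const 2).div_const _)

end Algebra

end Summit.Ventures.LatticeQCDFlow.Scoring

end
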